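import Summits.QuantumFields.YangMills.Theorems.BalabanUVNodesK1V7RDefs
import Summits.QuantumFields.YangMills.Theorems.BalabanUVNodesK1R9VersionSlotDefs
import Summits.QuantumFields.YangMills.Theorems.BalabanUVNodesK1R9BodyAtRevisedRecordWorldOfNodesRunLetters

/-!
# K1⁹ «v9» LINE 2 — THE THREE NEW REGISTERED V-STUB TEXTS' PREDICATES AS TREE DEFINITIONS (`RecordSV`, `NodesAtSomeRecord13PWSV`, `RunRowsAtSomeRecord13PWSV`, `RunRowsContAtSomeRecord13PWSV`),
# so that LINE-2 stub proofs and their suppliers can be filed BY NAME; the `refl` doors LINE 1 ⟹ LINE 2; the slot faces of an `RecordSⱽ` world; the rung projections; `Cont13All` ⟹ stub 3ⱽ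

Cell `ym-nodeO-ideate`, DEFINER seat `ym-nodeO-def-1` (gen 9).  `--kind definition --supports stmt-QuantumFields-27364 --as helper --no-relocate`; count-neutral.
Pattern and precedent: dag-n24-w1's `Thm/BalabanUVNodesK1V6Defs.lean` (K1⁷ v6) ∕ `Thm/BalabanUVNodesK1V7RDefs.lean` (K1⁸ v7ᴿ; BOTH IMPORTED here, nothing of theirs re-declared), this seat's
`Thm/BalabanUVNodesK1R9VersionSlotDefs.lean` (p624736: K1⁹ ∕ K2⁹ ∕ K3⁸ BY NAME, the version doors) over NODE 00's version slot `Literature/…/Node00/Record13SepCoPHV.lean` (p620607).  Invited by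
the planner of record: plan g86 `[YMPLAN-G86-K1V9-INTENT]` (pub-ymgap bus l.36351, 2026-08-28T10:55Z: «a `K1R9VersionSlotDefs`-style mirror of `RecordSV` ∕ the V-rungs is welcome»); director-ym
g10 №214 (v9: GO).  [I] = [Balaban1987RG1]; [II] = [Balaban1988RG2Cluster]; [III] = [Balaban1988Convergent]; [V] = [Balaban1989LargeFieldII]; [16] = [Balaban1985UV3]; [IV] = [Balaban1989LargeFieldI].

WHY.  Route `BalabanUVNodes` rev 29 (5c92291ad69b): the deciding crux is K1⁹ `StabilityBRunRowsAtRecordR13SepCoPHV` (stmt-QuantumFields-27364) — K1⁸'s text with a VERSION SLOT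
`v : Node00.Revision₁₃ F 2 θ h` in the witness tuple and (B) AS PRINTED of the re-chosen datum `Node00.datumOfRecord₁₃SepCoPHV F 2 θ h v`.  Plan g86's skeleton «v9» for that item
(`HOME/pub-ymgap-plan/D86-K1V9/K1Skeleton13SepCoPHv9.lean`, sha16 e3ea62ca8052a293, ns `…Theses.BalabanUVNodes.K1Skeleton13SepCoPHV9`) is the UNION of two alternative lines: LINE 1 =
v7ᴿ∕v8's three stubs byte-identical (`stub_nodes13PWS` ∕ `stub_runRows13PWS` ∕ `stub_cont13`, predicates = `K1V6Defs` ∕ `K1V7RDefs` names; the slot filled trivially through the `refl` door)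
and LINE 2 (§R9V) = the slot INSIDE the rows rung: `stub_nodes13PWSV : ∀ F : T4Family, Inhabited13 F → NodesAtSomeRecord13PWSV F` (XL; dag-n13-w1 g5 LOCATED-2: the version pin's carrier in
LINE 1 is `RecordS`'s clause `w.C = (datumOfRecord₁₃SepCoPH …).C`; LINE 2 re-keys the world's construction to the slot, so N13's [III] (2.50) is asked POINTWISE of SOME a.e.-representative
`v.ρ`, every other leaf version-blind), `stub_runRows13PWSV : ∀ F : T4Family, NodesAtSomeRecord13PWSV F → RunRowsAtSomeRecord13PWSV F` (L; LINE 1's stub 2″ content, θ-level),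
`stub_cont13V : ∀ F : T4Family, RunRowsAtSomeRecord13PWSV F → RunRowsContAtSomeRecord13PWSV F` (M–L; (C)).  The V-predicates are LOCAL to the skeleton (plan's HOME, never imported), so no
tree file can spell the three registered LINE-2 texts.  THIS FILE puts them into the tree BYTE-FOR-BYTE (v9 :368 ∕ :387 ∕ :395 ∕ :404 over `K1V6Defs.RecordS`'s letters), with the `refl` door
`recordSV_refl_iff` (v9 :374, `Iff.rfl` through `Node00.datumOfRecord₁₃SepCoPHV_refl`), the record-rebound twin (v9 :378), the three rung doors LINE 1 ⟹ LINE 2 (v9 :413 ∕ :418 ∕ :423), the slot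
faces of an `RecordSⱽ` world (its construction IS the revised datum's; its small-field part ∕ β ∕ flow ARE the record's — p620607's `rfl` faces), the rung projections (2ⱽ‴ ⟹ 2ⱽ ⟹ 1ⱽ; 2ⱽ‴ hands
DEF-1's per-tuple `RunRowsCont13 F θ` — K1⁹'s own rows conjunct — at its witness), and `Cont13All` ⟹ stub 3ⱽ's text (v9 :454 over the named rungs).

NOT IN THIS FILE (one declarer per statement): the V-END ROAD «END + window at the revised datum from the nodes at an `RecordSⱽ` world and the run letters» and the COMPOSITION «three V-texts ⟹
K1⁹» (v9 `endStatementBPrinted_window_of_recordSV_of_nodes_of_runLetters` ∕ `k1R9_of_stubsV`) — dag-n13-w3 g4's `Thm/BalabanUVNodesK1R9BodyAtRevisedRecordWorldOfNodesRunLetters.lean`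
(CLAIM-4 ∕ INTENT-5, pub-ymgap bus l.36240; p627483 ✓, IMPORTED here): §5 below composes K1⁹ BY NAME over the named rungs through THEIR road with one `exact` — the road itself is not restated.  The LINE-2
TWINS of the witness adapters ∕ ∃-side producers (level-free (C) junction, `RunRemAt` ⟹ rows + (C), box ∕ |β|-box + PS roads, ceiling-keyed roads) — dag-n24-w1's pre-claimed
`Thm/BalabanUVNodesK1V9Adapters.lean` (pub-ymgap bus l.36440, «NOT MINE — GO» to this file).  No stub, no skeleton
(the skeleton of record is the plan's v9; this file mirrors its texts — if the plan re-cuts, this file is superseded, not edited), LINE 1's texts (imported).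

CONTENTS (4 `def` + 15 theorems — §1 texts · §2 door ∕ twin ∕ faces · §3 rung doors ∕ projections · §4 `Cont13All` ⟹ stub 3ⱽ · §5 the composition BY NAME; 0 `sorry`; [folklore] bookkeeping; no `instance`, no `notation`, no `axiom`).

HONEST FRAMING.  Definitions (registered texts VERBATIM) + `Iff.rfl` ∕ binder bookkeeping; NOTHING of Bałaban asserted; NO stub is proved here; nothing registered or re-registered by this
seat; no density re-chosen, no a.e. statement proved; K0⁷ stmt-QuantumFields-20541 ∕ K1⁹ stmt-QuantumFields-27364 (DECIDING) ∕ K3⁸ stmt-QuantumFields-27366 OPEN (K2⁹ 27365 support CLOSED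
`proved`, p624498); (B)'s Cor-3 half, (D1) ∕ (D4) ∕ (C) NOT discharged; counts unmoved (typed 28∕28 · discharged 5∕27 (A 5∕28)).  [I] Thm 2 + (0.31) p. 259 and §1 pp. 263–264, and the
pointwise reading of [III] Cor. 3 (2.50) p. 264, are UNPROVED here and (the first two) in print.  Route R4 closes the CONDITIONAL finite-𝕋⁴ rung `BalabanLadder.UV` only — ONE kernel
implication on ONE finite 𝕋⁴ at fixed ε; NOT continuum, NOT ℝ⁴, NOT OS, NOT a mass gap, NOT Clay; the Yang–Mills mass gap is NOT proved by any of this.  Sources (context only): [V] Thm 1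
p. 355 + (0.1) pp. 355–356; [III] (0.2) p. 244, (2.18) p. 257, Cor. 3 (2.50) p. 264; [I] Thm 3 p. 264, (1.22) p. 264, (5.10) p. 293, §1 pp. 263–264; [II] (2.41) p. 21; [16] Thm 1 p. 257; [IV] (0.4)–(0.6) p. 176.
-/

noncomputable section

open scoped Matrix.Norms.L2Operator

namespace Summit.QuantumFields.YangMills.Theorems.K1V9Defs

open Literature.MathematicalPhysics.QuantumFieldTheory.Balaban1983to89
open Literature.MathematicalPhysics.QuantumFieldTheory.Balaban1983to89.T4Continuum
open Literature.MathematicalPhysics.QuantumFieldTheory.Balaban1983to89.DagBinding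
open FlowStepRuns
open FlowStep (HBeta RGEqH prefixOf)
open Summit.QuantumFields.YangMills.Theorems.BalabanUVNodesK2NamedJetsRunRemAt (RunRemAt RunConstRemainder SurvCont)
open Summit.QuantumFields.YangMills.Theorems.K1V6Defs (RecordS Inhabited13 NodesAtSomeRecord13PWS RunRowsAtSomeRecord13PWS Window)
open Summit.QuantumFields.YangMills.Theorems.K1V7RDefs (RunRowsContAtSomeRecord13PWS)
open Summit.QuantumFields.YangMills.Theorems.BalabanUVNodesK1R8RowsDefs (RunRowsCont13 Cont13All runRowsCont13_intro)

/-! ## §1 The v9 LINE-2 predicate texts, verbatim -/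

/-- **THE S-BOUND RECORD CLASS AT THE SLOT `RecordSⱽ`** (v9 :368 VERBATIM; dag-n13-w1 g5 LOCATED-2): `K1V6Defs.RecordS F θ h w` BYTE-KEPT except the ONE clause binding the world's construction,
now to the REVISED record datum `Node00.datumOfRecord₁₃SepCoPHV F 2 θ h v` (p620607) — SOME admissible separated-range parameter `θ'` presenting the SAME datum of record, window
`0 < w.γ ≤ θ'.γ`, block size, the S-binding of record over its Stage-13 view. HYPOTHESIS-SHAPE letter of the registered LINE-2 stubs.
(Locators, context only: Balaban1989LargeFieldII, Thm 1 + (0.1) pp.355–356; Balaban1988Convergent, (0.2) p.244, (2.18) p.257 (bookkeeping).) HYPOTHESIS SHAPE, never a fact. [folklore] -/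
def RecordSV (F : T4Family) (θ : Node00.Stage13HParams F 2) (h : θ.Provisos₁₃SepCoPH F 2) (v : Node00.Revision₁₃ F 2 θ h) (w : WorldP) : Prop :=
  ∃ (θ' : Node00.Stage13HParams F 2) (h' : θ'.Provisos₁₃SepCoPH F 2), θ'.Admissible F 2 ∧
    Node00.datumOfRecord₁₃SepCoPH F 2 θ h = Node00.datumOfRecord₁₃SepCoPH F 2 θ' h' ∧ w.C = (Node00.datumOfRecord₁₃SepCoPHV F 2 θ h v).C ∧ (0 < w.γ ∧ w.γ ≤ θ'.γ) ∧
    w.L = (θ'.L : ℝ) ∧ ∀ P : B12.RunParams, w.up P = Node00.upOfRecord₅CS F 2 (θ'.toStage5₁₃CoPH F 2) P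

/-- **rung 1ⱽ (LINE 2; v9 :387 VERBATIM = the CONCLUSION of registered `stub_nodes13PWSV`, the HYPOTHESIS of `stub_runRows13PWSV`)**: LINE 1's rung 1 `K1V6Defs.NodesAtSomeRecord13PWS` with the
witness tuple `(θ, h, v, w)` and the world in the slot class `RecordSⱽ F θ h v w` — the thirteen DAG nodes at every run of a world bound to SOME REVISED record datum (N13's `uvBounds` leaf then
reads [III] (2.50) POINTWISE on the re-chosen densities `v.ρ`; every other leaf version-blind), [B10] by name, [IV]'s basic step at the bundle of record (byte-kept).
(Locators, context only: Balaban1989LargeFieldII, Thm 1 p.355, (0.1) pp.355–356; Balaban1988Convergent, Cor. 3 (2.50) p.264, (0.2) p.244; Balaban1985UV3, Thm 1 p.257, Thm 2 p.272; Balaban1989LargeFieldI, (0.4)–(0.6) p.176 (statement shapes).) HYPOTHESIS SHAPE, never a fact. [folklore] -/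
def NodesAtSomeRecord13PWSV (F : T4Family) : Prop :=
  ∃ (θ : Node00.Stage13HParams F 2) (h : θ.Provisos₁₃SepCoPH F 2) (v : Node00.Revision₁₃ F 2 θ h) (w : WorldP), (θ.ZhUnity F 2 ∧ θ.SlotsNondegenerate₁₃ F 2) ∧ θ.Admissible F 2 ∧
    RecordSV F θ h v w ∧ (∀ P : B12.RunParams, Nodes (leavesP w P)) ∧ Node00.PrintedUV3V 2 θ.L ∧
    ∃ lam : Node00.ResidW F 2, (∀ P : B12.RunParams, 1 ≤ P.K → lam.kSel P < P.K) ∧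
      ∀ P : B12.RunParams, lam.kSel P < P.K → ((leavesP w P).rBasicStep ↔ B15Leaf (Node00.WOfRecord₁₃ F 2 θ.toStage13Params lam P))

/-- **rung 2ⱽ (LINE 2; v9 :395 VERBATIM = the CONCLUSION of registered `stub_runRows13PWSV`, the HYPOTHESIS of `stub_cont13V`)**: the rung-1ⱽ data AND the run rows (i)–(iv) of
`β_θ := Node00.betaOfRecord₁₃ F 2 θ.toStage13Params` on some level `γ₀ > 0` with the ceiling match `B + r ≤ w.βup` — LINE 1's stub 2″ content verbatim (θ-level, version-free:
`Node00.βfun_datumOfRecord₁₃SepCoPHV` is `rfl`). (Locators, context only: Balaban1987RG1, Thm 3 p.264, (1.22) p.264, (5.10) p.293; Balaban1988RG2Cluster, (2.41) p.21 (statement shapes).) HYPOTHESIS SHAPE, never a fact. [folklore] -/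
def RunRowsAtSomeRecord13PWSV (F : T4Family) : Prop :=
  ∃ (θ : Node00.Stage13HParams F 2) (h : θ.Provisos₁₃SepCoPH F 2) (v : Node00.Revision₁₃ F 2 θ h) (w : WorldP), (θ.ZhUnity F 2 ∧ θ.SlotsNondegenerate₁₃ F 2) ∧ θ.Admissible F 2 ∧
    RecordSV F θ h v w ∧ (∀ P : B12.RunParams, Nodes (leavesP w P)) ∧
    ∃ (b : ℕ → ℝ) (r γ₀ B M : ℝ), 0 < γ₀ ∧ RunConstRemainder (Node00.betaOfRecord₁₃ F 2 θ.toStage13Params) b r γ₀ ∧ (∀ k, b k ≤ B) ∧ B + r ≤ w.βup ∧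
      ∀ (n : ℕ) (gs : ℕ → ℝ), RGEqH n (Node00.betaOfRecord₁₃ F 2 θ.toStage13Params) gs → Step.InInterval γ₀ n gs →
        ∀ k, k ≤ n → -M ≤ ∑ j ∈ Finset.Ico k n, Node00.betaOfRecord₁₃ F 2 θ.toStage13Params j (prefixOf gs j)

/-- **rung 2ⱽ‴ (LINE 2; v9 :404 VERBATIM = the CONCLUSION of registered `stub_cont13V`)**: rung 2ⱽ AND (C) run-wise survivor continuity `SurvCont β_θ γ₀` at the same witness and level —
LINE 1's stub 3 content verbatim ([I] §1 pp.263–264: continuity of the effective-action coefficients in the couplings, asserted in print without proof).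
(Locators, context only: Balaban1987RG1, §1 pp.263–264, Thm 3 p.264 (statement shape only).) HYPOTHESIS SHAPE, never a fact. [folklore] -/
def RunRowsContAtSomeRecord13PWSV (F : T4Family) : Prop :=
  ∃ (θ : Node00.Stage13HParams F 2) (h : θ.Provisos₁₃SepCoPH F 2) (v : Node00.Revision₁₃ F 2 θ h) (w : WorldP), (θ.ZhUnity F 2 ∧ θ.SlotsNondegenerate₁₃ F 2) ∧ θ.Admissible F 2 ∧
    RecordSV F θ h v w ∧ (∀ P : B12.RunParams, Nodes (leavesP w P)) ∧
    ∃ (b : ℕ → ℝ) (r γ₀ B M : ℝ), 0 < γ₀ ∧ RunConstRemainder (Node00.betaOfRecord₁₃ F 2 θ.toStage13Params) b r γ₀ ∧ (∀ k, b k ≤ B) ∧ B + r ≤ w.βup ∧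
      (∀ (n : ℕ) (gs : ℕ → ℝ), RGEqH n (Node00.betaOfRecord₁₃ F 2 θ.toStage13Params) gs → Step.InInterval γ₀ n gs →
        ∀ k, k ≤ n → -M ≤ ∑ j ∈ Finset.Ico k n, Node00.betaOfRecord₁₃ F 2 θ.toStage13Params j (prefixOf gs j)) ∧
      SurvCont (Node00.betaOfRecord₁₃ F 2 θ.toStage13Params) γ₀

/-! ## §2 The `refl` door, the record-rebound twin, and the slot faces of an `RecordSⱽ` world -/

/-- **THE DOOR** (v9 :374; `Iff.rfl` through `Node00.datumOfRecord₁₃SepCoPHV_refl` = `rfl`): at the trivial revision the slot class IS LINE 1's `K1V6Defs.RecordS`. [cite: Balaban1988Convergent, (0.2) p.244 (bookkeeping)] -/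
theorem recordSV_refl_iff {F : T4Family} (θ : Node00.Stage13HParams F 2) (h : θ.Provisos₁₃SepCoPH F 2) (w : WorldP) :
    RecordSV F θ h (Node00.Revision₁₃.refl F 2 θ h) w ↔ RecordS F θ h w :=
  Iff.rfl

/-- **THE RECORD-REBOUND TWIN** (v9 :378): an `RecordSⱽ` world with its construction re-bound to the datum of record is an `RecordS` world, every other letter unchanged — the carrier of the
(0.20) guard on the V-END road (dag-n10-d's S-class headline reads `RecordS`). [cite: Balaban1989LargeFieldII, Thm 1 + (0.1) pp.355–356 (bookkeeping)] -/
theorem recordS_rebound_of_recordSV {F : T4Family} {θ : Node00.Stage13HParams F 2} {h : θ.Provisos₁₃SepCoPH F 2} {v : Node00.Revision₁₃ F 2 θ h} {w : WorldP}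
    (hR : RecordSV F θ h v w) : RecordS F θ h { w with C := (Node00.datumOfRecord₁₃SepCoPH F 2 θ h).C } := by
  obtain ⟨θ', h', hθ', hD, -, hγ, hL, hup⟩ := hR
  exact ⟨θ', h', hθ', hD, rfl, hγ, hL, hup⟩

/-- FACE: the world's construction at an `RecordSⱽ` world IS the revised datum's (the defining clause). [cite: Balaban1989LargeFieldII, Thm 1 + (0.1) pp.355–356 (bookkeeping)] -/
theorem recordSV_C_eq {F : T4Family} {θ : Node00.Stage13HParams F 2} {h : θ.Provisos₁₃SepCoPH F 2} {v : Node00.Revision₁₃ F 2 θ h} {w : WorldP}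
    (hR : RecordSV F θ h v w) : w.C = (Node00.datumOfRecord₁₃SepCoPHV F 2 θ h v).C := by
  obtain ⟨_, _, -, -, hC, -⟩ := hR
  exact hC

/-- FACE: … hence its SMALL-FIELD PART is the record's (`Node00.toB12_datumOfRecord₁₃SepCoPHV`, `rfl`) — END at an `RecordSⱽ` world is END of the record. [cite: Balaban1987RG1, Thm 1 p.259, Thm 2 p.259 (bookkeeping)] -/
theorem recordSV_toB12_eq {F : T4Family} {θ : Node00.Stage13HParams F 2} {h : θ.Provisos₁₃SepCoPH F 2} {v : Node00.Revision₁₃ F 2 θ h} {w : WorldP}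
    (hR : RecordSV F θ h v w) : w.C.toB12 = (Node00.datumOfRecord₁₃SepCoPH F 2 θ h).C.toB12 := by
  rw [recordSV_C_eq hR]; rfl

/-- FACE: … and every run's coupling FLOW at an `RecordSⱽ` world is the record's (`Node00.flow_datumOfRecord₁₃SepCoPHV`, `rfl`) — the (0.20) guard and the window read the same numbers at `w`
and at its record-rebound twin. [cite: Balaban1987RG1, (0.17)–(0.20) pp.255–256 (bookkeeping)] -/
theorem recordSV_flow_eq {F : T4Family} {θ : Node00.Stage13HParams F 2} {h : θ.Provisos₁₃SepCoPH F 2} {v : Node00.Revision₁₃ F 2 θ h} {w : WorldP}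
    (hR : RecordSV F θ h v w) (P : B12.RunParams) : (w.C P).flow = ((Node00.datumOfRecord₁₃SepCoPH F 2 θ h).C P).flow := by
  rw [recordSV_C_eq hR]; rfl

/-- FACE: the window `0 < w.γ ≤ θ'.γ ≤ …` — an `RecordSⱽ` world has a positive window (read off the class). [folklore] -/
theorem recordSV_γ_pos {F : T4Family} {θ : Node00.Stage13HParams F 2} {h : θ.Provisos₁₃SepCoPH F 2} {v : Node00.Revision₁₃ F 2 θ h} {w : WorldP}
    (hR : RecordSV F θ h v w) : 0 < w.γ := by
  obtain ⟨_, _, -, -, -, hγ, -⟩ := hR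
  exact hγ.1

/-! ## §3 The rung doors LINE 1 ⟹ LINE 2 (through `Revision₁₃.refl`) and the rung projections -/

/-- LINE 1 ⟹ LINE 2 at rung 1 (v9 :413; kernel, `refl` door): every LINE-1 rung-1 result — in particular a proof of the registered `stub_nodes13PWS` — feeds LINE 2's rung 1ⱽ.
So `stub_nodes13PWSV` is WEAKER than `stub_nodes13PWS`. [cite: Balaban1989LargeFieldII, Thm 1 p.355 (bookkeeping)] -/
theorem nodesAtSomeRecord13PWSV_of_line1 {F : T4Family} (hN : NodesAtSomeRecord13PWS F) : NodesAtSomeRecord13PWSV F := by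
  obtain ⟨θ, h, w, hU, hθ, hR, hnodes, h08, lam, hsel, hstep⟩ := hN
  exact ⟨θ, h, Node00.Revision₁₃.refl F 2 θ h, w, hU, hθ, (recordSV_refl_iff θ h w).2 hR, hnodes, h08, lam, hsel, hstep⟩

/-- LINE 1 ⟹ LINE 2 at rung 2 (v9 :418; kernel, `refl` door). [cite: Balaban1987RG1, Thm 3 p.264 (bookkeeping)] -/
theorem runRowsAtSomeRecord13PWSV_of_line1 {F : T4Family} (hN : RunRowsAtSomeRecord13PWS F) : RunRowsAtSomeRecord13PWSV F := by
  obtain ⟨θ, h, w, hU, hθ, hR, hnodes, b, r, γ₀, B, M, hγ₀, hrem, hB, hmatch, hps⟩ := hN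
  exact ⟨θ, h, Node00.Revision₁₃.refl F 2 θ h, w, hU, hθ, (recordSV_refl_iff θ h w).2 hR, hnodes, b, r, γ₀, B, M, hγ₀, hrem, hB, hmatch, hps⟩

/-- LINE 1 ⟹ LINE 2 at rung 2‴ (v9 :423; kernel, `refl` door). [cite: Balaban1987RG1, §1 pp.263–264 (bookkeeping)] -/
theorem runRowsContAtSomeRecord13PWSV_of_line1 {F : T4Family} (hN : RunRowsContAtSomeRecord13PWS F) : RunRowsContAtSomeRecord13PWSV F := by
  obtain ⟨θ, h, w, hU, hθ, hR, hnodes, b, r, γ₀, B, M, hγ₀, hrem, hB, hmatch, hps, hsc⟩ := hN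
  exact ⟨θ, h, Node00.Revision₁₃.refl F 2 θ h, w, hU, hθ, (recordSV_refl_iff θ h w).2 hR, hnodes, b, r, γ₀, B, M, hγ₀, hrem, hB, hmatch, hps, hsc⟩

/-- rung 2ⱽ‴ ⟹ rung 2ⱽ (drop (C)): every stub-3ⱽ witness is a stub-2ⱽ witness. [cite: Balaban1987RG1, Thm 3 p.264 (bookkeeping)] -/
theorem runRowsAtSomeRecord13PWSV_of_runRowsContAtSomeRecord13PWSV (F : T4Family) (h : RunRowsContAtSomeRecord13PWSV F) : RunRowsAtSomeRecord13PWSV F := by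
  obtain ⟨θ, hP, v, w, hU, hθ, hR, hnodes, b, r, γ₀, B, M, hγ₀, hrem, hB, hmatch, hps, -⟩ := h
  exact ⟨θ, hP, v, w, hU, hθ, hR, hnodes, b, r, γ₀, B, M, hγ₀, hrem, hB, hmatch, hps⟩

/-- rung 2ⱽ ⟹ rung 1ⱽ minus the pins is NOT a door (rung 2ⱽ drops [B10] and the [IV] pin); but rung 2ⱽ ⟹ «an `RecordSⱽ` world with the thirteen nodes at every run» — the V-END road's input. [folklore] -/
theorem exists_recordSV_nodes_of_runRowsAtSomeRecord13PWSV (F : T4Family) (h : RunRowsAtSomeRecord13PWSV F) :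
    ∃ (θ : Node00.Stage13HParams F 2) (h : θ.Provisos₁₃SepCoPH F 2) (v : Node00.Revision₁₃ F 2 θ h) (w : WorldP), (θ.ZhUnity F 2 ∧ θ.SlotsNondegenerate₁₃ F 2) ∧ θ.Admissible F 2 ∧
      RecordSV F θ h v w ∧ (∀ P : B12.RunParams, Nodes (leavesP w P)) := by
  obtain ⟨θ, hP, v, w, hU, hθ, hR, hnodes, -⟩ := h
  exact ⟨θ, hP, v, w, hU, hθ, hR, hnodes⟩

/-- **rung 2ⱽ‴ ⟹ DEF-1's PER-TUPLE ROWS `RunRowsCont13 F θ` (p616926 — K1⁹'s OWN rows conjunct, `K1R9VersionSlotDefs.stabilityBRunRowsAtRecordR13SepCoPHV_iff`) AT THE WITNESS**, together with the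
rung-1ⱽ data there (the bound `b ≤ B` and the ceiling match are dropped: they serve (B) and the window through the V-END road, not the rows). [cite: Balaban1987RG1, Thm 3 p.264, §1 pp.263–264 (bookkeeping)] -/
theorem exists_runRowsCont13_of_runRowsContAtSomeRecord13PWSV (F : T4Family) (h : RunRowsContAtSomeRecord13PWSV F) :
    ∃ (θ : Node00.Stage13HParams F 2) (h : θ.Provisos₁₃SepCoPH F 2) (v : Node00.Revision₁₃ F 2 θ h) (w : WorldP), (θ.ZhUnity F 2 ∧ θ.SlotsNondegenerate₁₃ F 2) ∧ θ.Admissible F 2 ∧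
      RecordSV F θ h v w ∧ (∀ P : B12.RunParams, Nodes (leavesP w P)) ∧ RunRowsCont13 F θ := by
  obtain ⟨θ, hP, v, w, hU, hθ, hR, hnodes, b, r, γ₀, B, M, hγ₀, hrem, -, -, hps, hsc⟩ := h
  exact ⟨θ, hP, v, w, hU, hθ, hR, hnodes, runRowsCont13_intro θ hγ₀ hrem hps hsc⟩

/-! ## §4 `Cont13All` ⟹ stub 3ⱽ's text -/

/-- **DEF-1's ∀θ LETTER `Cont13All` ⟹ STUB 3ⱽ's TEXT** (= v9's kernel bridge `stubCont13V_of_cont13All` :454, over the tree names): at a rows witness `(θ, h, v, w)` read (C) at the admissible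
PRESENTING tuple `θ'` of `RecordSⱽ` (same datum of record ⟹ same β, `Node00.βfun_datumOfRecord₁₃SepCoPH`) at the level `min γ₀ w.γ ≤ θ'.γ`, and cut the rows to that level (`RunConstRemainder.mono`;
the floor is antitone in the level).  So a proof of `Cont13All` closes the registered `stub_cont13V` BY NAME through this theorem, exactly as it closes LINE 1's `stub_cont13`
(`K1V7RDefs.stub_cont13_of_cont13All`).  CONDITIONAL on `hC`. [cite: Balaban1987RG1, §1 pp.263–264, Thm 3 p.264 (bookkeeping)] -/
theorem stub_cont13V_of_cont13All (hC : Cont13All) : ∀ F : T4Family, RunRowsAtSomeRecord13PWSV F → RunRowsContAtSomeRecord13PWSV F := by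
  intro F hrows
  obtain ⟨θ, h, v, w, hU, hθ, hR, hnodes, b, r, γ₀, B, M, hγ₀, hrem, hB, hmatch, hps⟩ := hrows
  obtain ⟨θ', h', hθ'adm, hD, hC', ⟨hwγ, hwγle⟩, hL, hup⟩ := hR
  have hγ₁ : 0 < min γ₀ w.γ := lt_min hγ₀ hwγ
  have hγ₁le : min γ₀ w.γ ≤ θ'.γ := (min_le_right _ _).trans hwγle
  have hβ : Node00.betaOfRecord₁₃ F 2 θ'.toStage13Params = Node00.betaOfRecord₁₃ F 2 θ.toStage13Params := by
    have := congrArg (fun D => D.βfun) hD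
    simpa [Node00.βfun_datumOfRecord₁₃SepCoPH] using this.symm
  have hsc : SurvCont (Node00.betaOfRecord₁₃ F 2 θ.toStage13Params) (min γ₀ w.γ) := by
    have := hC F θ' h' hθ'adm (min γ₀ w.γ) hγ₁ hγ₁le
    rwa [hβ] at this
  refine ⟨θ, h, v, w, hU, hθ, ⟨θ', h', hθ'adm, hD, hC', ⟨hwγ, hwγle⟩, hL, hup⟩, hnodes, b, r, min γ₀ w.γ, B, M, hγ₁, hrem.mono (min_le_left _ _), hB, hmatch, ?_, hsc⟩
  intro n gs hrg hI k hk
  exact hps n gs hrg (fun j hj => ⟨(hI j hj).1, (hI j hj).2.trans (min_le_left _ _)⟩) k hk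

/-! ## §5 The composition BY NAME: the three registered V-texts ⟹ K1⁹ (through dag-n13-w3's V-END road, p627483) -/

/-- **K1⁹ stmt-QuantumFields-27364 BY NAME FROM ONE PRODUCER «rung 0 ⟹ rung 2ⱽ‴»** (any road from K0⁷'s conclusion on `F` to a LINE-2 rows ∕ (C) witness; the three V-stubs composed are one
such): dag-n13-w3 g4's `K1R9BodyAtRevisedRecordWorldOfNodesRunLetters.stabilityBRunRowsAtRecordR13SepCoPHV_byName_of_rowsContWitnessV` (p627483: (B) and the `K ≥ 1` window AT THE REVISED
DATUM by the V-END road — p598782 §2 re-run at `D := Node00.datumOfRecord₁₃SepCoPHV F 2 θ h v`, the (0.20) guard read off the record-rebound twin — the rows (i)(iv)(C) read off the rung)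
over the NAMED rung `RunRowsContAtSomeRecord13PWSV` (its hypothesis is this file's §1 text with `RecordSV` unfolded; `exact` by δ).  CONDITIONAL on `h`; K1⁹ OPEN.
[cite: Balaban1989LargeFieldII, Thm 1 p.355 + (0.1) pp.355–356; Balaban1987RG1, Thm 3 p.264, (5.10) p.293, §1 pp.263–264; Balaban1988Convergent, Cor. 3 (2.50) p.264 (bookkeeping)] -/
theorem stabilityBRunRowsAtRecordR13SepCoPHV_of_rung0_runRowsContV (h : ∀ F : T4Family, Inhabited13 F → RunRowsContAtSomeRecord13PWSV F) :
    Summit.QuantumFields.YangMills.Theses.BalabanUVNodes.StabilityBRunRowsAtRecordR13SepCoPHV :=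
  Summit.QuantumFields.YangMills.BalabanUVNodes.K1R9BodyAtRevisedRecordWorldOfNodesRunLetters.stabilityBRunRowsAtRecordR13SepCoPHV_byName_of_rowsContWitnessV h

/-- **K1⁹ BY NAME FROM THE THREE REGISTERED LINE-2 STUB TEXTS** (`h₁` = `stub_nodes13PWSV`'s text, `h₂` = `stub_runRows13PWSV`'s, `h₃` = `stub_cont13V`'s; = plan g86 v9's composition
`k1R9_of_stubsV` ∕ `StabilityBRunRowsAtRecordR13SepCoPHV_proof` over the tree names, the slot filled by the WITNESS's OWN revision `v`).  So three by-name stub proofs close the DECIDING crux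
through this theorem (or through the sorry-free skeleton).  CONDITIONAL on the three texts; NO stub is proved here; K1⁹ OPEN.
[cite: Balaban1989LargeFieldII, Thm 1 p.355 + (0.1) pp.355–356; Balaban1987RG1, Thm 3 p.264, (5.10) p.293, §1 pp.263–264 (bookkeeping)] -/
theorem stabilityBRunRowsAtRecordR13SepCoPHV_of_stubTextsV
    (h₁ : ∀ F : T4Family, Inhabited13 F → NodesAtSomeRecord13PWSV F)
    (h₂ : ∀ F : T4Family, NodesAtSomeRecord13PWSV F → RunRowsAtSomeRecord13PWSV F)
    (h₃ : ∀ F : T4Family, RunRowsAtSomeRecord13PWSV F → RunRowsContAtSomeRecord13PWSV F) :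
    Summit.QuantumFields.YangMills.Theses.BalabanUVNodes.StabilityBRunRowsAtRecordR13SepCoPHV :=
  stabilityBRunRowsAtRecordR13SepCoPHV_of_rung0_runRowsContV fun F hinh => h₃ F (h₂ F (h₁ F hinh))

end Summit.QuantumFields.YangMills.Theorems.K1V9Defs

end
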